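import Summits.CriticalPhenomena.PercolationContinuityZ3.Theorems.PercNearOneGluingNoHeavyQuantDeficitFAR
import HarnessLib

/-!
# FAR beyond trees: the SURPLUS fixed-set FAR inequality at EVERY layer in the Cantelli regime — `P(N ≤ j)·(E N − 2j + 1) ≤ 1 − η`
# for independent trials with success probabilities in `[η, 1]`, mean `E N ≥ 2j` and `η·E N ≤ j²`

builds on p205010 (kernel theorem, internal audit signed; external expert review pending)

Support file (`--supports stmt-CriticalPhenomena-4575`), seat `prim-cert-1` (gen 41); memo `prim-cert-1/FROM-prim-cert-1-g41-ALL-LAYERS.md` §1.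
This is inequality **(∗)_j** of `prim-cert-1/FROM-prim-cert-1-g34-UNIVERSAL-WITNESS.md` §3 (the long-row half of THM B: "the weakest-hair bet
`W(μ_W)` is a hair-only certificate for `SunFAR K j` whenever `η(Σh − 2j) ≤ j(F − η)`") for a GENERAL layer `j`, in the regime `η·E N ≤ j²`.
KEY REMARK (memo §1): THM B only ever needs this regime — its hypothesis `η(Σ − 2j) ≤ j(F − η) ≤ j(1 − η)` forces `ηΣ ≤ j(1 + η) ≤ 2j ≤ j²`
(`j ≥ 2`), and every coverage set has `E(C) ≤ Σ`; so the exponential-moment regime `η·E N > j²` of the layer-two file (`Quant.CountDP.surplus_far_two`,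
gen 37: Chernoff + AM–GM + a numerical table) is never entered, and ONE Cantelli step proves the needed inequality uniformly in `j`.
Same local notation `PB[p, m] b` as `…QuantCountDP.lean`; pure real algebra on the recursion, no definitions, no sorries, standard axioms.

* **`Quant.CountDP.surplus_far_cantelli`** — for `η ≤ p k ≤ 1` (`k < m`), `1 ≤ j`, `2j ≤ E := Σ_{k<m} p k` and `η·E ≤ j²`:
  `(Σ_{i ≤ j} PB[p, m] i)·(E − 2j + 1) ≤ 1 − η`.
  PROOF: with `d = E − j ≥ j`, `W = (1−η)E ≥ Var`, Cantelli (`Quant.CountDP.sum_sq_dev` at centre `E + W/d`) gives `P(S ≤ j)·(d² + W) ≤ W`;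
  and `(E − 2j + 1)·E ≤ d² + W` is the identity `d² + W − (E − 2j + 1)E + ... ` i.e. `(j + u)² − (2j + u)(u + η) = j² − η(2j + u)`, `u = E − 2j`,
  nonnegative exactly when `ηE ≤ j²`.
Numerical re-check: seat folder `work/pb/` (random instances, all `j ≤ 8`; 0 violations; tight only at the sure corner).
Nearest prior art: Cantelli's inequality is folklore; the packaged statement is [this work].
-/

noncomputable section

namespace Summit.CriticalPhenomena.PercolationContinuityZ3.Theorems

namespace Quant

namespace CountDP

open Finset

/-- `PB[p, m] b` = probability that exactly `b` of the first `m` independent trials succeed (recursion on `m`, as in `…QuantCountDP.lean`). -/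
local notation3 "PB[" p ", " m "]" =>
  (Nat.rec (motive := fun _ => ℕ → ℝ) (fun b => if b = 0 then (1 : ℝ) else 0)
    (fun n f b => (p : ℕ → ℝ) n * (if b = 0 then (0 : ℝ) else f (b - 1)) + (1 - (p : ℕ → ℝ) n) * f b) (m : ℕ))

variable (p : ℕ → ℝ)

/-- **Cantelli for the lower tail of the count**: for `j < E := Σ_{k<m} p k` (`p ∈ [0,1]`), with `d = E − j` and `W = (1−η)E` any upper bound
of the variance coming from `η ≤ p k` (`k < m`):  `P(S_m ≤ j)·(d² + W) ≤ W`. [folklore] -/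
theorem cdf_cantelli (hp : ∀ k, 0 ≤ p k ∧ p k ≤ 1) {η : ℝ} {m : ℕ} (hη : ∀ k, k < m → η ≤ p k) (j : ℕ)
    (hjE : (j : ℝ) < ∑ k ∈ Finset.range m, p k) :
    (∑ i ∈ Finset.range (j + 1), PB[p, m] i) *
        ((∑ k ∈ Finset.range m, p k - j) ^ 2 + (1 - η) * ∑ k ∈ Finset.range m, p k) ≤
      (1 - η) * ∑ k ∈ Finset.range m, p k := by
  set E := ∑ k ∈ Finset.range m, p k with hEdef
  set C := ∑ i ∈ Finset.range (j + 1), PB[p, m] i with hCdef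
  set d := E - j with hddef
  have hd0 : 0 < d := by rw [hddef]; linarith
  have hEm : E ≤ m := by
    rw [hEdef]
    have := Finset.sum_le_sum (s := Finset.range m) (f := p) (g := fun _ => (1 : ℝ)) fun k _ => (hp k).2
    simpa using this
  have hjm : j ≤ m := by
    by_contra h
    have : (m : ℝ) ≤ j := by exact_mod_cast (show m ≤ j by omega)
    linarith
  have hη1 : η ≤ 1 := by
    have hm0 : 0 < m := by
      by_contra h
      have hm : m = 0 := by omega
      rw [hm] at hEm; push_cast at hEm
      have : (0 : ℝ) ≤ j := by positivity
      linarith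
    exact (hη 0 hm0).trans (hp 0).2
  have hE0 : 0 ≤ E := by have : (0 : ℝ) ≤ j := by positivity
                         linarith
  set W := (1 - η) * E with hWdef
  have hW0 : 0 ≤ W := mul_nonneg (by linarith) hE0
  have hvar : ∑ k ∈ Finset.range m, p k * (1 - p k) ≤ W := by
    rw [hWdef, hEdef, Finset.mul_sum]
    exact Finset.sum_le_sum fun k hk => by
      have := hη k (Finset.mem_range.1 hk)
      nlinarith [(hp k).1]
  have hmarkov : ∀ u : ℝ, 0 ≤ u → C * (d + u) ^ 2 ≤ ∑ b ∈ Finset.range (m + 1), (E + u - b) ^ 2 * PB[p, m] b := by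
    intro u hu
    calc C * (d + u) ^ 2 = ∑ i ∈ Finset.range (j + 1), (d + u) ^ 2 * PB[p, m] i := by
          rw [hCdef, Finset.sum_mul]; exact Finset.sum_congr rfl fun i _ => by ring
      _ ≤ ∑ i ∈ Finset.range (j + 1), (E + u - i) ^ 2 * PB[p, m] i := by
          refine Finset.sum_le_sum fun i hi => mul_le_mul_of_nonneg_right ?_ (PB_nonneg p hp m i)
          have hij : (i : ℝ) ≤ j := by exact_mod_cast (show i ≤ j by rw [Finset.mem_range] at hi; omega)
          have h1 : d + u ≤ E + u - i := by rw [hddef]; linarith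
          exact pow_le_pow_left₀ (by linarith) h1 2
      _ ≤ ∑ b ∈ Finset.range (m + 1), (E + u - b) ^ 2 * PB[p, m] b :=
          Finset.sum_le_sum_of_subset_of_nonneg (Finset.range_mono (by omega))
            fun b _ _ => mul_nonneg (sq_nonneg _) (PB_nonneg p hp m b)
  have hcant : ∀ u : ℝ, 0 ≤ u → C * (d + u) ^ 2 ≤ u ^ 2 + W := by
    intro u hu
    have h1 := hmarkov u hu
    rw [sum_sq_dev p m (E + u), ← hEdef] at h1
    have e : (E + u - E) ^ 2 = u ^ 2 := by ring
    rw [e] at h1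
    linarith
  -- `u = W/d`
  have h1 := hcant (W / d) (div_nonneg hW0 hd0.le)
  have e1 : d + W / d = (d ^ 2 + W) / d := by field_simp
  rw [e1, div_pow] at h1
  have hd2 : 0 < d ^ 2 := by positivity
  have h2 : C * (d ^ 2 + W) ^ 2 ≤ (W / d) ^ 2 * d ^ 2 + W * d ^ 2 := by
    have := mul_le_mul_of_nonneg_right h1 hd2.le
    rwa [mul_div_assoc', div_mul_cancel₀ _ hd2.ne', add_mul] at this
  have e2 : (W / d) ^ 2 * d ^ 2 = W ^ 2 := by field_simp
  rw [e2] at h2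
  have hS : 0 < d ^ 2 + W := by positivity
  have hC0 : 0 ≤ C := cdf_nonneg p hp m (j + 1)
  have : C * (d ^ 2 + W) * (d ^ 2 + W) ≤ W * (d ^ 2 + W) := by nlinarith
  exact le_of_mul_le_mul_right this hS

/-- **THE SURPLUS FIXED-SET FAR INEQUALITY AT EVERY LAYER, CANTELLI REGIME.**  For independent trials with success probabilities
`η ≤ p k ≤ 1` (`k < m`), a layer `j ≥ 1`, mean `E := Σ_{k<m} p k ≥ 2j` and `η·E ≤ j²`:  `P(S_m ≤ j)·(E − 2j + 1) ≤ 1 − η`.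
(The layer-two file `Quant.CountDP.surplus_far_two` has no `η·E ≤ 4` hypothesis; inside THM B this hypothesis is automatic, see the file header.)
[this work] -/
theorem surplus_far_cantelli (hp : ∀ k, 0 ≤ p k ∧ p k ≤ 1) {η : ℝ} {m : ℕ} (hη : ∀ k, k < m → η ≤ p k) {j : ℕ} (hj : 1 ≤ j)
    (hE : (2 * j : ℝ) ≤ ∑ k ∈ Finset.range m, p k) (hA : η * ∑ k ∈ Finset.range m, p k ≤ (j : ℝ) ^ 2) :
    (∑ i ∈ Finset.range (j + 1), PB[p, m] i) * (∑ k ∈ Finset.range m, p k - 2 * j + 1) ≤ 1 - η := by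
  set E := ∑ k ∈ Finset.range m, p k with hEdef
  set C := ∑ i ∈ Finset.range (j + 1), PB[p, m] i with hCdef
  have hj1 : (1 : ℝ) ≤ j := by exact_mod_cast hj
  have hjE : (j : ℝ) < E := by linarith
  have hkey := cdf_cantelli p hp hη j hjE
  rw [← hEdef, ← hCdef] at hkey
  set d := E - j with hddef
  set W := (1 - η) * E with hWdef
  have hC0 : 0 ≤ C := cdf_nonneg p hp m (j + 1)
  have hEm : E ≤ m := by
    rw [hEdef]
    have := Finset.sum_le_sum (s := Finset.range m) (f := p) (g := fun _ => (1 : ℝ)) fun k _ => (hp k).2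
    simpa using this
  have hη1 : η ≤ 1 := by
    have hm0 : 0 < m := by
      by_contra h
      have hm : m = 0 := by omega
      rw [hm] at hEm; push_cast at hEm
      linarith
    exact (hη 0 hm0).trans (hp 0).2
  -- `(E − 2j + 1)·E ≤ d² + W`  ⟺  `η E ≤ j²`
  have halg : (E - 2 * j + 1) * E ≤ d ^ 2 + W := by
    have e : d ^ 2 + W - (E - 2 * j + 1) * E = (j : ℝ) ^ 2 - η * E := by rw [hddef, hWdef]; ring
    linarith
  have hS : 0 < d ^ 2 + W := by
    have hd0 : 0 < d := by rw [hddef]; linarith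
    have hW0 : 0 ≤ W := mul_nonneg (by linarith) (by linarith)
    positivity
  have hu0 : 0 ≤ E - 2 * j + 1 := by linarith
  -- `C (u+1) (d² + W) ≤ (u+1) W = (u+1)(1−η)E ≤ (1−η)(d² + W)`
  have h1 : C * (E - 2 * j + 1) * (d ^ 2 + W) ≤ (E - 2 * j + 1) * W := by nlinarith
  have h2 : (E - 2 * j + 1) * W ≤ (1 - η) * (d ^ 2 + W) := by
    rw [hWdef]; nlinarith
  exact le_of_mul_le_mul_right (by linarith) hS

end CountDP

end Quant

end Summit.CriticalPhenomena.PercolationContinuityZ3.Theorems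

end
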